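import Literature.NumberTheory.Automorphic.ColumnGroupFourier
import Literature.NumberTheory.Automorphic.UnipotentColumnSplit
import Literature.NumberTheory.Automorphic.UnipotentColumnRangeHaar
import Literature.NumberTheory.Automorphic.UnipotentConjHaarChar
import HarnessLib

/-!
# The modulus of diagonal conjugation on the unipotent groups `U_{[a,b]}(𝔸_K)`: explicit formula

Topic `NumberTheory/Automorphic`; namespace `Literature.NumberTheory.Automorphic`. Conjugation
`u ↦ t u t⁻¹` by a diagonal matrix `t = diag(d₀, …, d_{n-1})` of ideles preserves every column-range
unipotent group `U_{[a,b]}(𝔸_K)` (`adelicColRange`, multiplying the entry `u_{ij}` by `dᵢ/dⱼ`); its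
**modulus** `δ_{[a,b]}(d) = mulEquivHaarChar` (the factor by which it expands Haar measure,
`colRangeDiagModulus`) is computed explicitly:

* `colRangeDiagModulus_split` — **multiplicativity along `U_{[a,b]} = U_{[m+1,b]} · U_{[a,m]}`**: the
  Haar measure of the product is the image of the product of Haar measures
  (`isHaarMeasure_map_colSplitHomeomorph`) and conjugation acts factorwise;
* `colRangeDiagModulus_col` — **one column**: `δ_{[c,c]}(d) = ∏_{i<c} ‖dᵢ/d_c‖` where
  `‖𝔞‖ = distribHaarChar 𝔸_K 𝔞` is the module of the idele `𝔞` (`= |𝔞|_𝔸`, Tate's Lemma 4.1.2,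
  `AdeleRing.distribHaarChar_eq_ideleNorm`): in the coordinates `x ↦ colVec x` of
  `ColumnGroupFourier` the conjugation is the coordinatewise scaling `xᵢ ↦ (dᵢ/d_c) xᵢ` of `𝔸_K^{c}`,
  which scales `⊗λ` by `∏ ‖dᵢ/d_c‖` (`map_smulPi_pi_eq_smul`);
* `colRangeDiagModulus_one_eq_prod` — hence **`δ_{[1,b]}(d) = ∏_{1 ≤ c ≤ b} ∏_{i<c} ‖dᵢ/d_c‖`**, in
  particular for `N_n(𝔸_K) = U_{[1,n-1]}(𝔸_K)` the modulus is `∏_{i<j} ‖dᵢ/dⱼ‖ = δ_B(t)`, the modular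
  character of the Borel subgroup (Godement, Sém. Bourbaki 257, §8: "the modulus of `Ad(a)` on
  `Lie(U_𝔸)` is a monomial in the simple roots"; Cogdell (2004), §2.3, the factor `δ_B⁻¹` of the
  Iwasawa integration formula). The consumers (the Iwasawa evaluation of the Rankin–Selberg tower)
  use the column-range groups `adelicColRange` directly; the qualitative object `unipotentConjChar` of
  `UnipotentConjHaarChar` lives on the (propositionally equal) subgroup `adelicUnipotent` and is not
  bridged here.

Everything is proved.

## References

* R. Godement, *Domaines fondamentaux des groupes arithmétiques*, Sém. Bourbaki 257 (1962/63), §8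
  [Godement1964].
* J. W. Cogdell, *Analytic theory of L-functions for GL_n* (2004), §2.3 [CogdellAnalyticTheory2004].
-/

noncomputable section

open MeasureTheory Measure NumberField IsDedekindDomain Matrix Set Filter Topology
open scoped MatrixGroups ENNReal NNReal Pointwise

namespace Literature.NumberTheory.Automorphic

/-! ### Algebra: diagonal conjugation preserves the column-range groups -/

section Algebra

variable {n : ℕ} {R : Type*} [CommRing R] {a b : ℕ}

/-- **`t u t⁻¹ ∈ U_{[a,b]}`** for `u ∈ U_{[a,b]}` and `t` diagonal (the entry `(i,j)` is multiplied by
`dᵢ dⱼ⁻¹`, so the zero pattern and the unit diagonal are preserved). [folklore] -/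
theorem glDiagonal_conj_mem_unipotentColRange (d : Fin n → Rˣ) {u : GL (Fin n) R}
    (hu : u ∈ unipotentColRange n R a b) :
    glDiagonal n R d * u * (glDiagonal n R d)⁻¹ ∈ unipotentColRange n R a b := by
  refine ⟨glDiagonal_mul_mul_glDiagonal_inv_mem_upperUnitriangular d hu.1, fun i j hij hj => ?_⟩
  rw [coe_glDiagonal_mul_mul_glDiagonal_inv_apply, hu.2 i j hij hj, mul_zero, zero_mul]

/-- The normalisation hypothesis of `colRangeConj` for a diagonal matrix. [folklore] -/
theorem mem_unipotentColRange_iff_glDiagonal_conj (d : Fin n → Rˣ) (u : GL (Fin n) R) :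
    u ∈ unipotentColRange n R a b ↔ glDiagonal n R d * u * (glDiagonal n R d)⁻¹ ∈ unipotentColRange n R a b := by
  refine ⟨glDiagonal_conj_mem_unipotentColRange d, fun h => ?_⟩
  have h' := glDiagonal_conj_mem_unipotentColRange d⁻¹ h
  simpa [map_inv, mul_assoc] using h'

end Algebra

/-! ### The conjugation automorphism of `U_{[a,b]}(𝔸_K)` and its modulus -/

section Modulus

variable {n : ℕ} {K : Type} [Field K] [NumberField K] (a b : ℕ)
variable [MeasurableSpace (GL (Fin n) (AdeleRing (𝓞 K) K))] [BorelSpace (GL (Fin n) (AdeleRing (𝓞 K) K))]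

/-- **Conjugation by `t = diag(d)` as a topological group automorphism of `U_{[a,b]}(𝔸_K)`.**
[folklore] -/
def colRangeDiagConj (d : Fin n → (AdeleRing (𝓞 K) K)ˣ) :
    ↥(adelicColRange n K a b) ≃ₜ* ↥(adelicColRange n K a b) :=
  colRangeConj (glDiagonal n (AdeleRing (𝓞 K) K) d) (mem_unipotentColRange_iff_glDiagonal_conj d)

omit [MeasurableSpace (GL (Fin n) (AdeleRing (𝓞 K) K))] [BorelSpace (GL (Fin n) (AdeleRing (𝓞 K) K))] in
/-- The underlying matrix of the conjugate. [folklore] -/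
@[simp]
theorem coe_colRangeDiagConj (d : Fin n → (AdeleRing (𝓞 K) K)ˣ) (u : ↥(adelicColRange n K a b)) :
    ((colRangeDiagConj (n := n) (K := K) a b d u : ↥(adelicColRange n K a b)) : GL (Fin n) (AdeleRing (𝓞 K) K)) =
      glDiagonal n (AdeleRing (𝓞 K) K) d * u * (glDiagonal n (AdeleRing (𝓞 K) K) d)⁻¹ := rfl

/-- **The modulus `δ_{[a,b]}(d)`** of the conjugation on `U_{[a,b]}(𝔸_K)`: the factor by which it
expands Haar measure (Mathlib `mulEquivHaarChar`; for `[a,b] = [1,n-1]` this is the modular character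
`δ_B(t)` of the Borel subgroup). [folklore] -/
def colRangeDiagModulus (d : Fin n → (AdeleRing (𝓞 K) K)ˣ) : ℝ≥0 :=
  mulEquivHaarChar (colRangeDiagConj (n := n) (K := K) a b d)

/-- `0 < δ_{[a,b]}(d)`. [folklore] -/
theorem colRangeDiagModulus_pos (d : Fin n → (AdeleRing (𝓞 K) K)ˣ) : 0 < colRangeDiagModulus (n := n) (K := K) a b d :=
  mulEquivHaarChar_pos _

variable {a b}

/-- **The modulus rescales every Haar measure**: `map (conj d) μ = δ(d)⁻¹ • μ`. [folklore] -/
theorem map_colRangeDiagConj_eq_smul (d : Fin n → (AdeleRing (𝓞 K) K)ˣ)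
    (μ : Measure ↥(adelicColRange n K a b)) [IsHaarMeasure μ] :
    μ.map (colRangeDiagConj (n := n) (K := K) a b d) =
      ((colRangeDiagModulus (n := n) (K := K) a b d : ℝ≥0∞)⁻¹) • μ := by
  have h := mulEquivHaarChar_smul_map μ (colRangeDiagConj (n := n) (K := K) a b d)
  have hc : (colRangeDiagModulus (n := n) (K := K) a b d : ℝ≥0∞) ≠ 0 := by
    exact_mod_cast (colRangeDiagModulus_pos a b d).ne'
  rw [← colRangeDiagModulus] at h
  calc μ.map (colRangeDiagConj (n := n) (K := K) a b d)
      = ((colRangeDiagModulus (n := n) (K := K) a b d : ℝ≥0∞)⁻¹ * colRangeDiagModulus (n := n) (K := K) a b d) •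
          μ.map (colRangeDiagConj (n := n) (K := K) a b d) := by
        rw [ENNReal.inv_mul_cancel hc ENNReal.coe_ne_top, one_smul]
    _ = ((colRangeDiagModulus (n := n) (K := K) a b d : ℝ≥0∞)⁻¹) •
          ((colRangeDiagModulus (n := n) (K := K) a b d : ℝ≥0) • μ.map (colRangeDiagConj (n := n) (K := K) a b d)) := by
        rw [mul_smul]; rfl
    _ = _ := by rw [h]

/-- **Identification of the modulus from any Haar measure**: if `map (conj d) μ = r⁻¹ • μ` for a Haar
measure `μ`, then `δ(d) = r` (compare on the Tate box, of finite positive measure). [folklore] -/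
theorem colRangeDiagModulus_eq_of_map_eq_smul (d : Fin n → (AdeleRing (𝓞 K) K)ˣ)
    (μ : Measure ↥(adelicColRange n K a b)) [IsHaarMeasure μ] {r : ℝ≥0∞}
    (h : μ.map (colRangeDiagConj (n := n) (K := K) a b d) = r⁻¹ • μ) :
    (colRangeDiagModulus (n := n) (K := K) a b d : ℝ≥0∞) = r := by
  have h1 := map_colRangeDiagConj_eq_smul (n := n) (K := K) d μ
  rw [h] at h1
  -- compare on the box, a set of finite positive measure
  have hbox0 : μ (colRangeTateDomain n K a b) ≠ 0 := (measure_colRangeTateDomain_pos_of_isHaarMeasure μ).ne'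
  have hboxtop : μ (colRangeTateDomain n K a b) ≠ ⊤ := (measure_colRangeTateDomain_lt_top μ).ne
  have h2 := congrArg (fun ν : Measure ↥(adelicColRange n K a b) => ν (colRangeTateDomain n K a b)) h1
  simp only [Measure.smul_apply, smul_eq_mul] at h2
  have h3 : r⁻¹ = ((colRangeDiagModulus (n := n) (K := K) a b d : ℝ≥0∞))⁻¹ :=
    (ENNReal.mul_left_inj hbox0 hboxtop).1 h2
  have h4 := congrArg Inv.inv h3
  simpa only [inv_inv] using h4.symm

/-! ### Multiplicativity along `U_{[a,b]} = U_{[m+1,b]} · U_{[a,m]}` -/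

/-- **`δ_{[a,b]}(d) = δ_{[m+1,b]}(d) · δ_{[a,m]}(d)`** for `a ≤ m + 1`, `m ≤ b`: the conjugation acts
factorwise on `U_{[m+1,b]} × U_{[a,m]} ≅ U_{[a,b]}` and a Haar measure of `U_{[a,b]}(𝔸_K)` is the image
of the product of Haar measures (`isHaarMeasure_map_colSplitHomeomorph`). [folklore] -/
theorem colRangeDiagModulus_split (m : ℕ) (hab : a ≤ m + 1) (hmb : m ≤ b) (d : Fin n → (AdeleRing (𝓞 K) K)ˣ) :
    colRangeDiagModulus (n := n) (K := K) a b d =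
      colRangeDiagModulus (n := n) (K := K) (m + 1) b d * colRangeDiagModulus (n := n) (K := K) a m d := by
  set μH : Measure ↥(adelicColRange n K (m + 1) b) := Measure.haar with hμH
  set μL : Measure ↥(adelicColRange n K a m) := Measure.haar with hμL
  set E := colSplitHomeomorph (n := n) (K := K) m hab hmb with hE
  haveI := isHaarMeasure_map_colSplitHomeomorph (n := n) (K := K) m hab hmb μH μL
  set ν : Measure ↥(adelicColRange n K a b) := (μH.prod μL).map E with hν
  set θ := colRangeDiagConj (n := n) (K := K) a b d with hθ
  set θH := colRangeDiagConj (n := n) (K := K) (m + 1) b d with hθH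
  set θL := colRangeDiagConj (n := n) (K := K) a m d with hθL
  set cH : ℝ≥0∞ := (colRangeDiagModulus (n := n) (K := K) (m + 1) b d : ℝ≥0∞) with hcH
  set cL : ℝ≥0∞ := (colRangeDiagModulus (n := n) (K := K) a m d : ℝ≥0∞) with hcL
  have hcH0 : cH ≠ 0 := by rw [hcH]; exact_mod_cast (colRangeDiagModulus_pos (m + 1) b d).ne'
  have hcL0 : cL ≠ 0 := by rw [hcL]; exact_mod_cast (colRangeDiagModulus_pos a m d).ne'
  -- conjugation acts factorwise
  have hcomm : (θ : ↥(adelicColRange n K a b) → ↥(adelicColRange n K a b)) ∘ E = E ∘ Prod.map θH θL := by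
    funext p
    refine Subtype.ext ?_
    change glDiagonal n _ d * ((p.1 : GL (Fin n) (AdeleRing (𝓞 K) K)) * p.2) * (glDiagonal n _ d)⁻¹ =
      (glDiagonal n _ d * p.1 * (glDiagonal n _ d)⁻¹) * (glDiagonal n _ d * p.2 * (glDiagonal n _ d)⁻¹)
    group
  have hE : Measurable E := E.continuous.measurable
  have hθm : Measurable θ := θ.continuous.measurable
  have hθHm : Measurable θH := θH.continuous.measurable
  have hθLm : Measurable θL := θL.continuous.measurable
  -- `map θ ν = (cH cL)⁻¹ • ν`
  have key : ν.map θ = (cH * cL)⁻¹ • ν := by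
    rw [hν, Measure.map_map hθm hE, hcomm, ← Measure.map_map hE (hθHm.prodMap hθLm),
      ← Measure.map_prod_map μH μL hθHm hθLm, map_colRangeDiagConj_eq_smul d μH,
      map_colRangeDiagConj_eq_smul d μL, Measure.prod_smul_left, Measure.prod_smul_right, smul_smul,
      Measure.map_smul, ENNReal.mul_inv (Or.inl hcH0) (Or.inl ENNReal.coe_ne_top)]
  have h := colRangeDiagModulus_eq_of_map_eq_smul (n := n) (K := K) d ν key
  rw [hcH, hcL, ← ENNReal.coe_mul] at h
  exact_mod_cast h

/-! ### One column: `δ_{[c,c]}(d) = ∏_{i<c} ‖dᵢ/d_c‖` -/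

/-- **Coordinatewise scaling of `⊗λ` on `𝔸_K^ι`**: for units `aᵢ`,
`(⊗λ) ∘ (x ↦ (aᵢ xᵢ)ᵢ)⁻¹ = (∏ᵢ ‖aᵢ‖)⁻¹ • ⊗λ`, `‖a‖ = distribHaarChar 𝔸_K a` the module of `a`
(`λ(a • s) = ‖a‖ λ(s)`, Mathlib `distribHaarChar_mul`, in each coordinate; `Measure.pi_eq`). [folklore] -/
theorem map_smulPi_pi_eq_smul {ι : Type} [Fintype ι] [MeasurableSpace (AdeleRing (𝓞 K) K)]
    [BorelSpace (AdeleRing (𝓞 K) K)] [LocallyCompactSpace (AdeleRing (𝓞 K) K)]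
    (lam : Measure (AdeleRing (𝓞 K) K)) [lam.IsAddHaarMeasure]
    (a : ι → (AdeleRing (𝓞 K) K)ˣ) :
    (Measure.pi fun _ : ι => lam).map (fun x : ι → AdeleRing (𝓞 K) K => fun i => (a i : AdeleRing (𝓞 K) K) * x i) =
      (∏ i, (distribHaarChar (AdeleRing (𝓞 K) K) (a i) : ℝ≥0∞))⁻¹ • Measure.pi fun _ : ι => lam := by
  haveI := secondCountableTopology_adeleRing K
  set S : (ι → AdeleRing (𝓞 K) K) → (ι → AdeleRing (𝓞 K) K) := fun x i => (a i : AdeleRing (𝓞 K) K) * x i with hS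
  have hSm : Measurable S := (continuous_pi fun i => continuous_const.mul (continuous_apply i)).measurable
  set C : ℝ≥0∞ := ∏ i, (distribHaarChar (AdeleRing (𝓞 K) K) (a i) : ℝ≥0∞) with hC
  have hC0 : C ≠ 0 := Finset.prod_ne_zero_iff.2 fun i _ => by exact_mod_cast (distribHaarChar_pos).ne'
  have hCtop : C ≠ ⊤ := ENNReal.prod_ne_top fun i _ => ENNReal.coe_ne_top
  -- `⊗λ = C • map S (⊗λ)` by the values on boxes
  have key : (Measure.pi fun _ : ι => lam) = C • (Measure.pi fun _ : ι => lam).map S := by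
    refine Measure.pi_eq fun s hs => ?_
    rw [Measure.smul_apply, Measure.map_apply hSm (MeasurableSet.univ_pi hs)]
    have hpre : S ⁻¹' Set.pi Set.univ s = Set.pi Set.univ fun i => ((a i)⁻¹ : (AdeleRing (𝓞 K) K)ˣ) • s i := by
      ext x
      simp only [Set.mem_preimage, Set.mem_univ_pi, hS, Set.mem_smul_set_iff_inv_smul_mem, inv_inv]
      simp only [Units.smul_def, smul_eq_mul]
    rw [hpre, Measure.pi_pi]
    have hcoord : ∀ i, lam (((a i)⁻¹ : (AdeleRing (𝓞 K) K)ˣ) • s i) =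
        (distribHaarChar (AdeleRing (𝓞 K) K) (a i) : ℝ≥0∞)⁻¹ * lam (s i) := by
      intro i
      rw [← distribHaarChar_mul, map_inv, ENNReal.coe_inv (distribHaarChar_pos).ne']
    simp_rw [hcoord]
    rw [Finset.prod_mul_distrib, smul_eq_mul, ← mul_assoc, hC, ← Finset.prod_mul_distrib,
      Finset.prod_eq_one (fun i _ => ENNReal.mul_inv_cancel (by exact_mod_cast (distribHaarChar_pos).ne')
        ENNReal.coe_ne_top), one_mul]
  calc (Measure.pi fun _ : ι => lam).map S
      = C⁻¹ • (C • (Measure.pi fun _ : ι => lam).map S) := by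
        rw [smul_smul, ENNReal.inv_mul_cancel hC0 hCtop, one_smul]
    _ = C⁻¹ • Measure.pi fun _ : ι => lam := by rw [← key]

omit [MeasurableSpace (GL (Fin n) (AdeleRing (𝓞 K) K))] [BorelSpace (GL (Fin n) (AdeleRing (𝓞 K) K))] in
/-- **In column coordinates the conjugation is a coordinatewise scaling**:
`t (colVec x) t⁻¹ = colVec ((dᵢ/d_c) xᵢ)ᵢ`. [folklore] -/
theorem colRangeDiagConj_colVecY {c : ℕ} (hc : c < n) (d : Fin n → (AdeleRing (𝓞 K) K)ˣ)
    (x : ColIdx n c → AdeleRing (𝓞 K) K) :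
    colRangeDiagConj (n := n) (K := K) c c d (colVecY c x) =
      colVecY c (fun i => ((d i.1 * (d ⟨c, hc⟩)⁻¹ : (AdeleRing (𝓞 K) K)ˣ) : AdeleRing (𝓞 K) K) * x i) := by
  refine Subtype.ext ?_
  rw [coe_colRangeDiagConj, coe_colVecY, coe_colVecY]
  have hmem : glDiagonal n (AdeleRing (𝓞 K) K) d * colVecGL c x * (glDiagonal n (AdeleRing (𝓞 K) K) d)⁻¹ ∈
      unipotentColRange n (AdeleRing (𝓞 K) K) c c :=
    glDiagonal_conj_mem_unipotentColRange d (colVecGL_mem c x)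
  rw [← colVecGL_entries_eq c hc hmem]
  congr 1
  funext i
  rw [coe_glDiagonal_mul_mul_glDiagonal_inv_apply, colVecGL_colEntry c hc, Units.val_mul]
  ring

/-- **One column: `δ_{[c,c]}(d) = ∏_{i<c} ‖dᵢ/d_c‖`.** In the coordinates `colVec` the conjugation
scales the coordinate `i` by `dᵢ/d_c`, which scales `⊗λ`, hence the Haar measure `colVec_*(⊗λ)`, by
`∏ ‖dᵢ/d_c‖`. [folklore] -/
theorem colRangeDiagModulus_col [LocallyCompactSpace (AdeleRing (𝓞 K) K)] {c : ℕ} (hc : c < n)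
    (d : Fin n → (AdeleRing (𝓞 K) K)ˣ) :
    (colRangeDiagModulus (n := n) (K := K) c c d : ℝ≥0∞) =
      ∏ i : ColIdx n c, (distribHaarChar (AdeleRing (𝓞 K) K) (d i.1 * (d ⟨c, hc⟩)⁻¹) : ℝ≥0∞) := by
  letI : MeasurableSpace (AdeleRing (𝓞 K) K) := borel _
  haveI : BorelSpace (AdeleRing (𝓞 K) K) := ⟨rfl⟩
  haveI := secondCountableTopology_adeleRing K
  set lam : Measure (AdeleRing (𝓞 K) K) := Measure.addHaar with hlam
  haveI := isHaarMeasure_map_colVecHomeomorph (n := n) (K := K) c hc lam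
  set V := colVecHomeomorph (n := n) (K := K) c hc with hV
  set μY : Measure ↥(adelicColRange n K c c) := (Measure.pi fun _ : ColIdx n c => lam).map V with hμY
  set a : ColIdx n c → (AdeleRing (𝓞 K) K)ˣ := fun i => d i.1 * (d ⟨c, hc⟩)⁻¹ with ha
  set S : (ColIdx n c → AdeleRing (𝓞 K) K) → (ColIdx n c → AdeleRing (𝓞 K) K) :=
    fun x i => (a i : AdeleRing (𝓞 K) K) * x i with hS
  set θ := colRangeDiagConj (n := n) (K := K) c c d with hθ
  have hcomm : (θ : ↥(adelicColRange n K c c) → ↥(adelicColRange n K c c)) ∘ V = V ∘ S := by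
    funext x
    exact colRangeDiagConj_colVecY hc d x
  have hVm : Measurable V := V.continuous.measurable
  have hSm : Measurable S := (continuous_pi fun i => continuous_const.mul (continuous_apply i)).measurable
  have hθm : Measurable (θ : ↥(adelicColRange n K c c) → ↥(adelicColRange n K c c)) := θ.continuous.measurable
  have key : μY.map θ = (∏ i : ColIdx n c, (distribHaarChar (AdeleRing (𝓞 K) K) (a i) : ℝ≥0∞))⁻¹ • μY := by
    rw [hμY, Measure.map_map hθm hVm, hcomm, ← Measure.map_map hVm hSm,
      map_smulPi_pi_eq_smul lam a, Measure.map_smul]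
  exact colRangeDiagModulus_eq_of_map_eq_smul (n := n) (K := K) d μY key

/-- The column factor `∏_{i<c} ‖dᵢ/d_c‖` (junk `1` if `c ≥ n`). [folklore] -/
def colDiagFactor [LocallyCompactSpace (AdeleRing (𝓞 K) K)] (d : Fin n → (AdeleRing (𝓞 K) K)ˣ) (c : ℕ) : ℝ≥0∞ :=
  if hc : c < n then ∏ i : ColIdx n c, (distribHaarChar (AdeleRing (𝓞 K) K) (d i.1 * (d ⟨c, hc⟩)⁻¹) : ℝ≥0∞)
  else 1

/-- The trivial range: `δ_{[1,0]}(d) = 1` (the group `U_{[1,0]}` is trivial, hence compact).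
[folklore] -/
theorem colRangeDiagModulus_one_zero (d : Fin n → (AdeleRing (𝓞 K) K)ˣ) :
    colRangeDiagModulus (n := n) (K := K) 1 0 d = 1 := by
  have hbot : adelicColRange n K 1 0 = ⊥ :=
    unipotentColRange_eq_bot fun j h => by have := h.1; have := h.2; omega
  haveI : Subsingleton ↥(adelicColRange n K 1 0) :=
    ⟨fun u v => Subtype.ext (((Subgroup.eq_bot_iff_forall _).1 hbot _ u.2).trans
      ((Subgroup.eq_bot_iff_forall _).1 hbot _ v.2).symm)⟩
  exact mulEquivHaarChar_eq_one_of_compactSpace _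

/-- **The modulus of diagonal conjugation on `U_{[1,b]}(𝔸_K)`**:
`δ_{[1,b]}(d) = ∏_{1 ≤ c ≤ b} ∏_{i<c} ‖dᵢ/d_c‖` (`b < n`; for `b = n - 1` this is `N_n(𝔸_K)` and the
right side is `∏_{i<j} ‖dᵢ/dⱼ‖ = δ_B(t)`). [folklore] -/
theorem colRangeDiagModulus_one_eq_prod [LocallyCompactSpace (AdeleRing (𝓞 K) K)]
    (d : Fin n → (AdeleRing (𝓞 K) K)ˣ) :
    ∀ b : ℕ, b < n → (colRangeDiagModulus (n := n) (K := K) 1 b d : ℝ≥0∞) =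
      ∏ c ∈ Finset.Icc 1 b, colDiagFactor (K := K) d c
  | 0, _ => by
    rw [colRangeDiagModulus_one_zero]
    simp
  | b + 1, hb => by
    rw [colRangeDiagModulus_split (a := 1) (b := b + 1) b (by omega) (by omega) d, ENNReal.coe_mul,
      colRangeDiagModulus_one_eq_prod d b (by omega), colRangeDiagModulus_col hb d,
      Finset.prod_Icc_succ_top (by omega : 1 ≤ b + 1), mul_comm]
    unfold colDiagFactor
    rw [dif_pos hb]

end Modulus

end Literature.NumberTheory.Automorphic
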